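import Summits.BirchSwinnertonDyer.BirchSwinnertonDyer.Theorems.Rank2ObservatoryCubicFieldR329701
import HarnessLib

/-!
# BirchSwinnertonDyer — rank ≥ 2 observatory: class number one of the cubic field of `-68 + 101 * X - 21 * X ^ 2 + X ^ 3` (`Δ = 329701`) — certificates at the primes 149, 151, 157

HONEST FRAMING: per-curve certified theorems and census instruments; no claim on BSD in rank ≥ 2.

Companion of the per-FIELD file `Rank2ObservatoryCubicFieldR329701` of the KERNEL-2DESC instrument (design
`b2b-bsdr2-cert-3/KERNEL-2DESC.md` §9e–§9g): the degree-one prime-element certificates at the primes 149, 151, 157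
(part b). Split off for file size; generated by the same generator from the same checked data.
Sorry-free; axioms `propext`, `Classical.choice`, `Quot.sound`.
[cite: Marcus2018, Ch. 3 Thm. 27, Ch. 5 Cor. 2 of Thm. 37]
-/

-- single-conjunct summit: `Summit.BirchSwinnertonDyer.BirchSwinnertonDyer.…` repeats the name by design
set_option linter.dupNamespace false

noncomputable section

open scoped Classical NumberField

open Literature.NumberTheory.NumberFields Polynomial Module NumberField

namespace Summit.BirchSwinnertonDyer.BirchSwinnertonDyer.Rank2Observatory.TwoDescCubic

namespace FieldR329701

/-! ## Class number one -/

/-- Certificate at `149`: every ring map `ψ : 𝓞 K → ℤ/149` kills a prime element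
(`α ↦ 80`: `-11 + 2 * α` (norm `-149`); `α ↦ 111`: `-173 + 41 * α - 2 * α ^ 2` (norm `-149`); `α ↦ 128`: `-25 + 36 * α - 6 * α ^ 2` (norm `149`)). [cite: Marcus2018, Ch. 3, Thm. 27] -/
theorem cert149 (ψ : 𝓞 (CubicField (-21) 101 (-68)) →+* ZMod 149) : ∃ e : 𝓞 (CubicField (-21) 101 (-68)), ψ e = 0 ∧ Prime e := by
  refine cert_of_cases aeval_α ψ (fun t ht hF => ?_)
  have hroots : ∀ t : ZMod 149,
      t ^ 3 + (((-21) : ℤ) : ZMod 149) * t ^ 2 + ((101 : ℤ) : ZMod 149) * t + (((-68) : ℤ) : ZMod 149) = 0 → t = 80 ∨ t = 111 ∨ t = 128 := by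
    decide +kernel
  rcases hroots t hF with rfl | rfl | rfl
  · exact ⟨lin aeval_α (-11) 2 0, by simp only [lin, map_add, map_mul, map_pow, map_intCast, ht]; decide,
      lin_prime_of_prime irreducible aeval_α finrank_eq (-11) 2 0 (n := (-149))
        (by norm_num [MonicCubic.normForm]) (by norm_num)⟩
  · exact ⟨lin aeval_α (-173) 41 (-2), by simp only [lin, map_add, map_mul, map_pow, map_intCast, ht]; decide,
      lin_prime_of_prime irreducible aeval_α finrank_eq (-173) 41 (-2) (n := (-149))
        (by norm_num [MonicCubic.normForm]) (by norm_num)⟩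
  · exact ⟨lin aeval_α (-25) 36 (-6), by simp only [lin, map_add, map_mul, map_pow, map_intCast, ht]; decide,
      lin_prime_of_prime irreducible aeval_α finrank_eq (-25) 36 (-6) (n := 149)
        (by norm_num [MonicCubic.normForm]) (by norm_num)⟩

/-- Certificate at `151`: `g` has no root mod `151`, so there is no ring map `𝓞 K → ℤ/151`. [folklore] -/
theorem cert151 (ψ : 𝓞 (CubicField (-21) 101 (-68)) →+* ZMod 151) : ∃ e : 𝓞 (CubicField (-21) 101 (-68)), ψ e = 0 ∧ Prime e :=
  cert_of_no_root aeval_α ψ (by decide +kernel)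

/-- Certificate at `157`: `g` has no root mod `157`, so there is no ring map `𝓞 K → ℤ/157`. [folklore] -/
theorem cert157 (ψ : 𝓞 (CubicField (-21) 101 (-68)) →+* ZMod 157) : ∃ e : 𝓞 (CubicField (-21) 101 (-68)), ψ e = 0 ∧ Prime e :=
  cert_of_no_root aeval_α ψ (by decide +kernel)

end FieldR329701

end Summit.BirchSwinnertonDyer.BirchSwinnertonDyer.Rank2Observatory.TwoDescCubic

end
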